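import Mathlib

/-!
# Row-sum determinant bound and the stochastic-Jacobian inequality `|det S| ≤ 1`

Kernel anchor for `DENSITY-XY.md` THEOREM G.34, Step 4 (repair cell b2b-imbrie, XY / free-fermion
rung).  For the Jacobi matrix `J(a,b)` with simple spectrum `ν` and normalised eigenvectors `ψᵢ`, the
Jacobian of `a ↦ spec J(a,b)` is `S = (ψᵢ(j)²)`, a (doubly) stochastic matrix; the chart formula gives
the pattern density as a fibre sum `g_b(ν) = Σ_{a ∈ fibre} |det S(a)|⁻¹`.  The elementary facts recorded
here are: the `ℓ¹`-row/column (Leibniz) bound `|det A| ≤ ∏ᵢ Σⱼ |Aᵢⱼ|` (a permanent of non-negative reals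
is at most the product of the row sums), hence `|det S| ≤ 1` for every row-substochastic `S`, hence each
fibre point contributes at least `1` and a fibre with `N` points has density `≥ N` (`= n!` in G.34).
Elementary real algebra only; nothing here asserts anything about the interacting chain (LLA).
-/

namespace Literature.MathematicalPhysics.QuantumLattice.Imbrie2016

open Finset

/-- A permanent of non-negative reals is at most the product of the column sums:
`Σ_σ ∏ᵢ a (σ i) i ≤ ∏ᵢ Σⱼ a j i`.  [folklore] -/
theorem sum_perm_prod_le_prod_sum_of_nonneg {ι : Type*} [Fintype ι] [DecidableEq ι]
    (a : ι → ι → ℝ) (ha : ∀ i j, 0 ≤ a i j) :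
    ∑ σ : Equiv.Perm ι, ∏ i, a (σ i) i ≤ ∏ i, ∑ j, a j i := by
  classical
  rw [Finset.prod_univ_sum]
  have h : ∑ σ : Equiv.Perm ι, ∏ i, a (σ i) i =
      ∑ f ∈ (Finset.univ : Finset (Equiv.Perm ι)).image (fun σ : Equiv.Perm ι => (⇑σ : ι → ι)),
        ∏ i, a (f i) i := by
    rw [Finset.sum_image fun (σ : Equiv.Perm ι) _ (τ : Equiv.Perm ι) _ (h : (⇑σ : ι → ι) = ⇑τ) =>
      Equiv.ext (congrFun h)]
  rw [h]
  refine Finset.sum_le_sum_of_subset_of_nonneg (fun f _ => ?_) fun f _ _ => ?_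
  · exact Fintype.mem_piFinset.2 fun _ => Finset.mem_univ _
  · exact Finset.prod_nonneg fun i _ => ha _ _

/-- **Column-sum Leibniz bound**: `|det A| ≤ ∏ᵢ Σⱼ |A j i|`.  [folklore] -/
theorem abs_det_le_prod_col_sum {ι : Type*} [Fintype ι] [DecidableEq ι] (A : Matrix ι ι ℝ) :
    |A.det| ≤ ∏ i, ∑ j, |A j i| := by
  classical
  rw [Matrix.det_apply']
  refine (Finset.abs_sum_le_sum_abs _ _).trans ?_
  calc ∑ σ : Equiv.Perm ι, |(Equiv.Perm.sign σ : ℝ) * ∏ i, A (σ i) i|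
      = ∑ σ : Equiv.Perm ι, ∏ i, |A (σ i) i| := by
        refine Finset.sum_congr rfl fun σ _ => ?_
        have hsign : |(Equiv.Perm.sign σ : ℝ)| = 1 := by
          rcases Int.units_eq_one_or (Equiv.Perm.sign σ) with hs | hs <;> simp [hs]
        rw [abs_mul, hsign, one_mul, Finset.abs_prod]
    _ ≤ ∏ i, ∑ j, |A j i| :=
        sum_perm_prod_le_prod_sum_of_nonneg (fun j i => |A j i|) fun _ _ => abs_nonneg _

/-- **Row-sum Leibniz bound** (`ℓ¹` Hadamard): `|det A| ≤ ∏ᵢ Σⱼ |A i j|`.  [folklore] -/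
theorem abs_det_le_prod_row_sum {ι : Type*} [Fintype ι] [DecidableEq ι] (A : Matrix ι ι ℝ) :
    |A.det| ≤ ∏ i, ∑ j, |A i j| := by
  rw [← Matrix.det_transpose]
  exact abs_det_le_prod_col_sum A.transpose

/-- **Stochastic Jacobian**: a matrix with non-negative entries and row sums `≤ 1` has
`|det S| ≤ 1` (G.34 Step 4: `S = (ψᵢ(j)²)`).  [folklore] -/
theorem abs_det_le_one_of_rowSubstochastic {ι : Type*} [Fintype ι] [DecidableEq ι]
    (S : Matrix ι ι ℝ) (h0 : ∀ i j, 0 ≤ S i j) (h1 : ∀ i, ∑ j, S i j ≤ 1) :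
    |S.det| ≤ 1 := by
  refine (abs_det_le_prod_row_sum S).trans ?_
  refine Finset.prod_le_one (fun i _ => Finset.sum_nonneg fun j _ => abs_nonneg _) fun i _ => ?_
  calc ∑ j, |S i j| = ∑ j, S i j := Finset.sum_congr rfl fun j _ => abs_of_nonneg (h0 i j)
    _ ≤ 1 := h1 i

/-- At a regular fibre point the chart weight is at least one: `1 ≤ |det S|⁻¹`.  [folklore] -/
theorem one_le_inv_abs_det_of_rowSubstochastic {ι : Type*} [Fintype ι] [DecidableEq ι]
    (S : Matrix ι ι ℝ) (h0 : ∀ i j, 0 ≤ S i j) (h1 : ∀ i, ∑ j, S i j ≤ 1) (hS : S.det ≠ 0) :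
    1 ≤ |S.det|⁻¹ := by
  have hpos : 0 < |S.det| := abs_pos.2 hS
  rw [le_inv_comm₀ one_pos hpos, inv_one]
  exact abs_det_le_one_of_rowSubstochastic S h0 h1

/-- **Fibre count lower bound** (G.34: `g_b(ν) ≥ #fibre = n!`): a fibre sum of chart weights
`|det S(a)|⁻¹` over finitely many regular points with row-substochastic Jacobians is at least the
number of points.  [folklore] -/
theorem card_le_sum_inv_abs_det {ι α : Type*} [Fintype ι] [DecidableEq ι] (F : Finset α)
    (S : α → Matrix ι ι ℝ) (h0 : ∀ a ∈ F, ∀ i j, 0 ≤ S a i j)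
    (h1 : ∀ a ∈ F, ∀ i, ∑ j, S a i j ≤ 1) (hS : ∀ a ∈ F, (S a).det ≠ 0) :
    (F.card : ℝ) ≤ ∑ a ∈ F, |(S a).det|⁻¹ := by
  calc (F.card : ℝ) = ∑ _a ∈ F, (1 : ℝ) := by simp
    _ ≤ ∑ a ∈ F, |(S a).det|⁻¹ :=
        Finset.sum_le_sum fun a ha =>
          one_le_inv_abs_det_of_rowSubstochastic (S a) (h0 a ha) (h1 a ha) (hS a ha)

end Literature.MathematicalPhysics.QuantumLattice.Imbrie2016
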